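import Literature.Computability.MetaComplexity.EFLogic
import Literature.Computability.MetaComplexity.EFAdder
import HarnessLib

/-!
# Derivability with size bounds: a compositional layer over blocks

Infrastructure for the extended Frege proof-construction kit (`EFScaffold.lean`,
`EFNetlist.lean`, `EFLogic.lean`): instead of naming the lines of every law explicitly, laws are
stated and composed through the predicate `FregeSystem.Yields G Γ Δ s` — *there is a block over
the available set `Γ`, of size at most `s`, after which every formula of `Δ` is available* — which
is closed under sequential composition (`Yields.trans`), union, monotonicity and bounded
iteration (`Yields.iterate`), and unpacks into an explicit block at the very end
(`Yields.exists_block`, for `Scaffold.exists_isEFProofOf_le`).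

All facts manipulated by the arithmetic layers are *lists of context-free bodies* `L` read under
a context `K` as the lines `K ∨ L` (`Netlist.ctx`): `Holds K Γ Ls` says that these lines are in
`Γ`, `ctxSet K Ls` is the set of them. In this form, weakening into an extended context
(`Yields.weaken`, for case analyses `Yields.cases`) and the word-level toolkit (bitwise
equality of words `eqW`, literal vectors `litW`: reflexivity, symmetry, transitivity, transport,
clash) are stated once for all layers.

## Sources

* S. A. Cook, R. A. Reckhow, *The relative efficiency of propositional proof systems*,
  J. Symbolic Logic 44 (1979), §2 (sound schematic rules, derivations "with hypotheses"), §4.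
* J. Krajíček, *Bounded Arithmetic, Propositional Logic, and Complexity Theory* (CUP 1995),
  Lemma 4.4.9–4.4.10 (instances of fixed schemes; the deduction lemma, here: contexts).

## Design notes

* `Yields` hides the block (an existential); sizes are explicit natural numbers so that the
  final polynomial bound is assembled by arithmetic only.
* Nothing here is specific to one tautology family.
-/

namespace Literature.Computability.MetaComplexity

open _root_.Computability Complexity Complexity.PropForm Netlist

namespace FregeSystem

variable {G G' : FregeSystem} {Γ Γ' Δ Δ' Δ₁ Δ₂ : Set (PropForm ℕ)} {s s' s₁ s₂ : ℕ}

/-- `G.Yields Γ Δ s`: there is a block over the available set `Γ` (`FregeSystem.IsBlock`) of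
`proofSize ≤ s` after which every formula of `Δ` is available (in `Γ` or among its lines).
[cite: CookReckhow1979, Thm. 2.3 (proof: derivations with hypotheses)] -/
def Yields (G : FregeSystem) (Γ Δ : Set (PropForm ℕ)) (s : ℕ) : Prop :=
  ∃ D : List (PropForm ℕ), G.IsBlock Γ D ∧ Δ ⊆ Γ ∪ {χ | χ ∈ D} ∧ proofSize D ≤ s

namespace Yields

/-- Already available formulas are derived by the empty block. [folklore] -/
theorem of_subset (G : FregeSystem) (h : Δ ⊆ Γ) (s : ℕ) : G.Yields Γ Δ s :=
  ⟨[], IsBlock.nil G Γ, fun _ hθ => Or.inl (h hθ), Nat.zero_le s⟩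

/-- Monotonicity: more available formulas, fewer conclusions, larger size bound. [folklore] -/
theorem mono (h : G.Yields Γ Δ s) (hΓ : Γ ⊆ Γ') (hΔ : Δ' ⊆ Δ) (hs : s ≤ s') : G.Yields Γ' Δ' s' := by
  obtain ⟨D, hD, hsub, hsize⟩ := h
  exact ⟨D, hD.mono hΓ, fun θ hθ => (hsub (hΔ hθ)).imp (fun h => hΓ h) id, hsize.trans hs⟩

/-- Monotonicity in the available set. [folklore] -/
theorem mono_left (h : G.Yields Γ Δ s) (hΓ : Γ ⊆ Γ') : G.Yields Γ' Δ s :=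
  h.mono hΓ subset_rfl le_rfl

/-- Monotonicity in the conclusions. [folklore] -/
theorem mono_right (h : G.Yields Γ Δ s) (hΔ : Δ' ⊆ Δ) : G.Yields Γ Δ' s :=
  h.mono subset_rfl hΔ le_rfl

/-- Monotonicity in the size bound. [folklore] -/
theorem mono_size (h : G.Yields Γ Δ s) (hs : s ≤ s') : G.Yields Γ Δ s' :=
  h.mono subset_rfl subset_rfl hs

/-- Monotonicity in the rule list. [folklore] -/
theorem mono_rules (h : G.Yields Γ Δ s) (hG : ∀ r ∈ G.rules, r ∈ G'.rules) : G'.Yields Γ Δ s := by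
  obtain ⟨D, hD, hsub, hsize⟩ := h
  exact ⟨D, hD.mono_rules hG, hsub, hsize⟩

/-- The available formulas stay available. [folklore] -/
theorem left_subset (h : G.Yields Γ Δ s) : G.Yields Γ (Γ ∪ Δ) s := by
  obtain ⟨D, hD, hsub, hsize⟩ := h
  exact ⟨D, hD, Set.union_subset Set.subset_union_left hsub, hsize⟩

/-- **Sequential composition**: derive `Δ₁`, then `Δ₂` from `Γ ∪ Δ₁`; sizes add. [folklore] -/
theorem trans (h₁ : G.Yields Γ Δ₁ s₁) (h₂ : G.Yields (Γ ∪ Δ₁) Δ₂ s₂) :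
    G.Yields Γ (Δ₁ ∪ Δ₂) (s₁ + s₂) := by
  obtain ⟨D₁, hD₁, hsub₁, hsize₁⟩ := h₁
  obtain ⟨D₂, hD₂, hsub₂, hsize₂⟩ := h₂
  have hΓ : Γ ∪ Δ₁ ⊆ Γ ∪ {χ | χ ∈ D₁} := Set.union_subset Set.subset_union_left hsub₁
  refine ⟨D₁ ++ D₂, hD₁.append (hD₂.mono hΓ), ?_, ?_⟩
  · rintro θ (hθ | hθ)
    · rcases hsub₁ hθ with h | h
      · exact Or.inl h
      · exact Or.inr (List.mem_append_left _ h)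
    · rcases hsub₂ hθ with h | h
      · rcases hΓ h with h' | h'
        · exact Or.inl h'
        · exact Or.inr (List.mem_append_left _ h')
      · exact Or.inr (List.mem_append_right _ h)
  · rw [proofSize_append]
    exact Nat.add_le_add hsize₁ hsize₂

/-- Two derivations from the same available set; sizes add. [folklore] -/
theorem union (h₁ : G.Yields Γ Δ₁ s₁) (h₂ : G.Yields Γ Δ₂ s₂) : G.Yields Γ (Δ₁ ∪ Δ₂) (s₁ + s₂) :=
  h₁.trans (h₂.mono_left Set.subset_union_left)

/-- One inference from available formulas. [cite: CookReckhow1979, §2] -/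
theorem single {θ : PropForm ℕ} (h : G.IsInferredFrom Γ θ) : G.Yields Γ {θ} θ.size :=
  ⟨[θ], IsBlock.of_isInferredFrom h, by simp, by simp [proofSize]⟩

/-- An explicit block gives a derivation of its lines. [folklore] -/
theorem of_isBlock {D : List (PropForm ℕ)} (h : G.IsBlock Γ D) (hΔ : Δ ⊆ {χ | χ ∈ D})
    (hs : proofSize D ≤ s) : G.Yields Γ Δ s :=
  ⟨D, h, fun _ hθ => Or.inr (hΔ hθ), hs⟩

/-- **Unpacking**: a derivation of `θ` yields a block containing the line `θ` (the block of the
derivation followed, if necessary, by a repetition of `θ`). [folklore] -/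
theorem exists_block {θ : PropForm ℕ} (h : G.Yields Γ {θ} s) :
    ∃ D : List (PropForm ℕ), G.IsBlock Γ D ∧ θ ∈ D ∧ proofSize D ≤ s + θ.size := by
  obtain ⟨D, hD, hsub, hsize⟩ := h
  refine ⟨D ++ [θ], hD.snoc (Or.inl (hsub rfl)), by simp, ?_⟩
  rw [proofSize_append, proofSize_singleton]
  exact Nat.add_le_add_right hsize _

/-- A family of lines each inferred from `Γ` alone is derived by listing them.
[folklore] -/
theorem pointwise {line : ℕ → PropForm ℕ} {W c : ℕ} (h : ∀ i < W, line i ∈ Γ ∨ G.IsInferredFrom Γ (line i))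
    (hc : ∀ i < W, (line i).size ≤ c) : G.Yields Γ {θ | ∃ i < W, θ = line i} (W * c) := by
  refine ⟨(List.range W).map line, isBlock_map_range W fun k hk => (h k hk).imp id fun hinf =>
    hinf.mono Set.subset_union_left, ?_, proofSize_map_range_le hc⟩
  rintro θ ⟨i, hi, rfl⟩
  exact Or.inr (mem_map_range hi)

/-- **Bounded iteration** (induction along positions): if `Δ 0` is available and each `Δ (j+1)`
is derived in size `c` from `Γ` and all earlier `Δ i` (`i ≤ j`), then all `Δ j`, `j ≤ N`, are
derived in size `N · c`. [folklore] -/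
theorem iterate {Δ : ℕ → Set (PropForm ℕ)} {c : ℕ} (h0 : Δ 0 ⊆ Γ)
    (hstep : ∀ j, G.Yields (Γ ∪ ⋃ i ≤ j, Δ i) (Δ (j + 1)) c) :
    ∀ N : ℕ, G.Yields Γ (⋃ j ≤ N, Δ j) (N * c)
  | 0 => of_subset G (by simpa using h0) _
  | N + 1 => by
    have ih := iterate h0 hstep N
    have h := ih.trans (hstep N)
    rw [Nat.succ_mul]
    refine h.mono_right ?_
    intro θ hθ
    simp only [Set.mem_iUnion, exists_prop] at hθ
    obtain ⟨j, hj, hθ⟩ := hθ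
    rcases Nat.lt_succ_iff_lt_or_eq.1 (Nat.lt_succ_of_le hj) with hj' | rfl
    · exact Or.inl (Set.mem_iUnion₂.2 ⟨j, Nat.lt_succ_iff.1 hj', hθ⟩)
    · exact Or.inr hθ

end Yields

/-! ### Facts as body lists under a context -/

/-- The set of lines `K ∨ L`, `L ∈ Ls`. [folklore] -/
def ctxSet (K : PropForm ℕ) (Ls : List (PropForm ℕ)) : Set (PropForm ℕ) := {θ | ∃ L ∈ Ls, θ = ctx K L}

/-- `Holds K Γ Ls`: every line `K ∨ L`, `L ∈ Ls`, is available in `Γ`. [folklore] -/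
def Holds (K : PropForm ℕ) (Γ : Set (PropForm ℕ)) (Ls : List (PropForm ℕ)) : Prop := ∀ L ∈ Ls, ctx K L ∈ Γ

/-- Membership in `ctxSet`. [folklore] -/
theorem mem_ctxSet_iff {K L : PropForm ℕ} {Ls : List (PropForm ℕ)} : ctx K L ∈ ctxSet K Ls ↔ L ∈ Ls := by
  constructor
  · rintro ⟨L', hL', h⟩
    simp only [ctx, disj.injEq, true_and] at h
    rw [h]
    exact hL'
  · exact fun h => ⟨L, h, rfl⟩

/-- A listed body gives a member of `ctxSet`. [folklore] -/
theorem mem_ctxSet {K L : PropForm ℕ} {Ls : List (PropForm ℕ)} (h : L ∈ Ls) : ctx K L ∈ ctxSet K Ls :=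
  ⟨L, h, rfl⟩

/-- `Holds` is `ctxSet ⊆`. [folklore] -/
theorem holds_iff_ctxSet_subset {K : PropForm ℕ} {Ls : List (PropForm ℕ)} : Holds K Γ Ls ↔ ctxSet K Ls ⊆ Γ := by
  constructor
  · rintro h θ ⟨L, hL, rfl⟩
    exact h L hL
  · exact fun h L hL => h (mem_ctxSet hL)

/-- The lines of `ctxSet K Ls` hold in any set containing it. [folklore] -/
theorem holds_ctxSet {K : PropForm ℕ} {Ls : List (PropForm ℕ)} (h : ctxSet K Ls ⊆ Γ) : Holds K Γ Ls :=
  holds_iff_ctxSet_subset.2 h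

namespace Holds

variable {K : PropForm ℕ} {Ls Ls' : List (PropForm ℕ)}

/-- Monotonicity in the set. [folklore] -/
theorem mono (h : Holds K Γ Ls) (hΓ : Γ ⊆ Γ') : Holds K Γ' Ls := fun L hL => hΓ (h L hL)

/-- Monotonicity in the list. [folklore] -/
theorem of_subset (h : Holds K Γ Ls) (hL : ∀ L ∈ Ls', L ∈ Ls) : Holds K Γ Ls' := fun L hL' => h L (hL L hL')

/-- Appending lists of facts. [folklore] -/
theorem append (h : Holds K Γ Ls) (h' : Holds K Γ Ls') : Holds K Γ (Ls ++ Ls') := fun L hL => by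
  rcases List.mem_append.1 hL with hL | hL
  exacts [h L hL, h' L hL]

/-- The subset form. [folklore] -/
theorem ctxSet_subset (h : Holds K Γ Ls) : ctxSet K Ls ⊆ Γ := holds_iff_ctxSet_subset.1 h

end Holds

/-- `ctxSet` of an append. [folklore] -/
theorem ctxSet_append (K : PropForm ℕ) (Ls Ls' : List (PropForm ℕ)) :
    ctxSet K (Ls ++ Ls') = ctxSet K Ls ∪ ctxSet K Ls' := by
  ext θ
  simp only [ctxSet, List.mem_append, Set.mem_setOf_eq, Set.mem_union]
  constructor
  · rintro ⟨L, hL | hL, rfl⟩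
    exacts [Or.inl ⟨L, hL, rfl⟩, Or.inr ⟨L, hL, rfl⟩]
  · rintro (⟨L, hL, rfl⟩ | ⟨L, hL, rfl⟩)
    exacts [⟨L, Or.inl hL, rfl⟩, ⟨L, Or.inr hL, rfl⟩]

/-- `ctxSet` of a map over a range is a family of lines. [folklore] -/
theorem ctxSet_map_range (K : PropForm ℕ) (f : ℕ → PropForm ℕ) (W : ℕ) :
    ctxSet K ((List.range W).map f) = {θ | ∃ i < W, θ = ctx K (f i)} := by
  ext θ
  simp only [ctxSet, List.mem_map, List.mem_range, Set.mem_setOf_eq]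
  constructor
  · rintro ⟨L, ⟨i, hi, rfl⟩, rfl⟩
    exact ⟨i, hi, rfl⟩
  · rintro ⟨i, hi, rfl⟩
    exact ⟨f i, ⟨i, hi, rfl⟩, rfl⟩

namespace Yields

variable {K : PropForm ℕ}

/-- A family of contextualised lines over a range, each available or inferred from `Γ` alone.
[folklore] -/
theorem ctx_range {f : ℕ → PropForm ℕ} {W c : ℕ}
    (h : ∀ i < W, ctx K (f i) ∈ Γ ∨ G.IsInferredFrom Γ (ctx K (f i))) (hc : ∀ i < W, (f i).size ≤ c) :
    G.Yields Γ (ctxSet K ((List.range W).map f)) (W * (K.size + c + 1)) := by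
  rw [ctxSet_map_range]
  exact pointwise h fun i hi => by simp only [ctx, size]; have := hc i hi; omega

/-! ### Weakening into an extended context and case analysis -/

/-- **Weakening**: facts under the context `K` are re-derived under the extended context `K ∨ A`
(one inference each). [cite: CookReckhow1979, §2] -/
theorem weaken (hG : ∀ r ∈ Logic.rules, r ∈ G.rules) {Ls : List (PropForm ℕ)} (h : Holds K Γ Ls)
    (A : PropForm ℕ) {c : ℕ} (hc : ∀ L ∈ Ls, L.size ≤ c) :
    G.Yields Γ (ctxSet (disj K A) Ls) (Ls.length * (K.size + A.size + c + 2)) := by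
  refine of_isBlock (Logic.isBlock_weakLines hG K A h) ?_ ?_
  · rintro θ ⟨L, hL, rfl⟩
    exact Logic.mem_weakLines hL
  · rw [Logic.proofSize_weakLines]
    have : ∀ x ∈ Ls.map (fun L => K.size + A.size + L.size + 2), x ≤ K.size + A.size + c + 2 := by
      intro x hx
      obtain ⟨L, hL, rfl⟩ := List.mem_map.1 hx
      have := hc L hL
      omega
    have h := List.sum_le_card_nsmul _ _ this
    simpa using h

/-- The positive case hypothesis `(K ∨ ¬A) ∨ A` is derived from nothing. [cite: CookReckhow1979, §2] -/
theorem caseHypT (hG : ∀ r ∈ Logic.rules, r ∈ G.rules) (K A : PropForm ℕ) :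
    G.Yields Γ {ctx (disj K (neg A)) A} (K.size + 2 * A.size + 3) := by
  have h := single (Logic.isInferredFrom_caseT hG K A (S := Γ))
  refine h.mono_size (le_of_eq ?_)
  simp [ctx, size]
  ring

/-- The negative case hypothesis `(K ∨ A) ∨ ¬A` is derived from nothing. [cite: CookReckhow1979, §2] -/
theorem caseHypF (hG : ∀ r ∈ Logic.rules, r ∈ G.rules) (K A : PropForm ℕ) :
    G.Yields Γ {ctx (disj K A) (neg A)} (K.size + 2 * A.size + 3) := by
  have h := single (Logic.isInferredFrom_caseF hG K A (S := Γ))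
  refine h.mono_size (le_of_eq ?_)
  simp [ctx, size]
  ring

/-- **Case analysis**: if the lines `(K ∨ ¬A) ∨ L` (case `A`) and `(K ∨ A) ∨ L` (case `¬A`) are
derived for all `L ∈ Ls`, then so are the merged lines `K ∨ L`. [cite: CookReckhow1979, §2] -/
theorem cases (hG : ∀ r ∈ Logic.rules, r ∈ G.rules) {A : PropForm ℕ} {Ls : List (PropForm ℕ)} {c : ℕ}
    (h₁ : G.Yields Γ (ctxSet (disj K (neg A)) Ls) s₁) (h₂ : G.Yields Γ (ctxSet (disj K A) Ls) s₂)
    (hc : ∀ L ∈ Ls, L.size ≤ c) :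
    G.Yields Γ (ctxSet K Ls) (s₁ + s₂ + Ls.length * (K.size + c + 1)) := by
  obtain ⟨D₁, hD₁, hsub₁, hsize₁⟩ := h₁
  obtain ⟨D₂, hD₂, hsub₂, hsize₂⟩ := h₂
  have hT : ∀ L ∈ Ls, ctx (disj K (neg A)) L ∈ Γ ∪ {χ | χ ∈ D₁} ∪ {χ | χ ∈ D₂} := fun L hL => by
    rcases hsub₁ (mem_ctxSet hL) with h | h
    · exact Or.inl (Or.inl h)
    · exact Or.inl (Or.inr h)
  have hF : ∀ L ∈ Ls, ctx (disj K A) L ∈ Γ ∪ {χ | χ ∈ D₁} ∪ {χ | χ ∈ D₂} := fun L hL => by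
    rcases hsub₂ (mem_ctxSet hL) with h | h
    · exact Or.inl (Or.inl h)
    · exact Or.inr h
  refine of_isBlock (D := D₁ ++ D₂ ++ Logic.mergeLines K Ls)
    (Logic.isBlock_cases hG hD₁ (hD₂.mono Set.subset_union_left) hT hF) ?_ ?_
  · rintro θ ⟨L, hL, rfl⟩
    exact List.mem_append_right _ (Logic.mem_mergeLines hL)
  · rw [proofSize_append, proofSize_append, Logic.proofSize_mergeLines]
    have : ∀ x ∈ Ls.map (fun L => K.size + L.size + 1), x ≤ K.size + c + 1 := by
      intro x hx
      obtain ⟨L, hL, rfl⟩ := List.mem_map.1 hx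
      have := hc L hL
      omega
    have h := List.sum_le_card_nsmul _ _ this
    simp only [List.length_map, smul_eq_mul] at h
    omega

end Yields

/-! ### The word-level toolkit: bitwise equalities and literal vectors -/

/-- The bodies `aᵢ ↔ bᵢ`, `i < W`, of the bitwise equality of two `W`-bit words (variables by
position). [folklore] -/
def eqW (a b : ℕ → ℕ) (W : ℕ) : List (PropForm ℕ) := (List.range W).map fun i => eqv (a i) (b i)

/-- The literal of a variable with a prescribed truth value. [folklore] -/
def lit (v : ℕ) : Bool → PropForm ℕ
  | true => var v
  | false => neg (var v)

/-- The bodies of a literal vector: the word `a` carries the bits `bits`. [folklore] -/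
def litW (a : ℕ → ℕ) (bits : ℕ → Bool) (W : ℕ) : List (PropForm ℕ) := (List.range W).map fun i => lit (a i) (bits i)

/-- Membership in `eqW`. [folklore] -/
theorem mem_eqW {a b : ℕ → ℕ} {W i : ℕ} (hi : i < W) : eqv (a i) (b i) ∈ eqW a b W :=
  List.mem_map.2 ⟨i, List.mem_range.2 hi, rfl⟩

/-- Membership in `litW`. [folklore] -/
theorem mem_litW {a : ℕ → ℕ} {bits : ℕ → Bool} {W i : ℕ} (hi : i < W) : lit (a i) (bits i) ∈ litW a bits W :=
  List.mem_map.2 ⟨i, List.mem_range.2 hi, rfl⟩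

/-- `Holds` of `eqW`, pointwise. [folklore] -/
theorem holds_eqW_iff {K : PropForm ℕ} {a b : ℕ → ℕ} {W : ℕ} :
    Holds K Γ (eqW a b W) ↔ ∀ i < W, ctx K (eqv (a i) (b i)) ∈ Γ := by
  simp [Holds, eqW]

/-- `Holds` of `litW`, pointwise. [folklore] -/
theorem holds_litW_iff {K : PropForm ℕ} {a : ℕ → ℕ} {bits : ℕ → Bool} {W : ℕ} :
    Holds K Γ (litW a bits W) ↔ ∀ i < W, ctx K (lit (a i) (bits i)) ∈ Γ := by
  simp [Holds, litW]

/-- `eqW` only depends on the words below `W`. [folklore] -/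
theorem eqW_congr {a a' b b' : ℕ → ℕ} {W : ℕ} (ha : ∀ i < W, a i = a' i) (hb : ∀ i < W, b i = b' i) :
    eqW a b W = eqW a' b' W :=
  List.map_congr_left fun i hi => by rw [ha i (List.mem_range.1 hi), hb i (List.mem_range.1 hi)]

/-- `litW` only depends on the word and bits below `W`. [folklore] -/
theorem litW_congr {a a' : ℕ → ℕ} {bits bits' : ℕ → Bool} {W : ℕ} (ha : ∀ i < W, a i = a' i)
    (hb : ∀ i < W, bits i = bits' i) : litW a bits W = litW a' bits' W :=
  List.map_congr_left fun i hi => by rw [ha i (List.mem_range.1 hi), hb i (List.mem_range.1 hi)]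

/-- Size of a literal. [folklore] -/
theorem size_lit_le (v : ℕ) (b : Bool) : (lit v b).size ≤ 2 := by
  cases b <;> simp [lit, size]

/-- Size of a bit equality. [folklore] -/
theorem size_eqv (u v : ℕ) : (eqv u v).size = 9 := by
  simp [eqv, FregeSystem.size_biimp, size]

namespace Yields

variable {K : PropForm ℕ} {a b d : ℕ → ℕ} {bits : ℕ → Bool} {W : ℕ}

/-- **Reflexivity** of bitwise equality (one axiom instance per bit). [cite: CookReckhow1979, §2] -/
theorem eqW_refl (hG : ∀ r ∈ Adder.rules, r ∈ G.rules) (K : PropForm ℕ) (a : ℕ → ℕ) (W : ℕ) :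
    G.Yields Γ (ctxSet K (eqW a a W)) (W * (K.size + 10)) :=
  ctx_range (fun i _ => Or.inr (FregeSystem.IsInferredFrom.of_rule (hG _ Adder.mem_rules.1)
    (FregeSystem.sub [K, var (a i)]) rfl FregeSystem.prems_nil)) fun _ _ => (size_eqv _ _).le

/-- **Symmetry** of bitwise equality. [cite: CookReckhow1979, §2] -/
theorem eqW_symm (hG : ∀ r ∈ Logic.rules, r ∈ G.rules) (h : Holds K Γ (eqW a b W)) :
    G.Yields Γ (ctxSet K (eqW b a W)) (W * (K.size + 10)) :=
  ctx_range (fun i hi => Or.inr (Logic.infer hG 5 (by decide) (FregeSystem.sub [K, var (a i), var (b i)]) rfl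
    (FregeSystem.prems_cons (holds_eqW_iff.1 h i hi) FregeSystem.prems_nil))) fun _ _ => (size_eqv _ _).le

/-- **Transitivity** of bitwise equality. [cite: CookReckhow1979, §2] -/
theorem eqW_trans (hG : ∀ r ∈ Logic.rules, r ∈ G.rules) (h₁ : Holds K Γ (eqW a b W)) (h₂ : Holds K Γ (eqW b d W)) :
    G.Yields Γ (ctxSet K (eqW a d W)) (W * (K.size + 10)) :=
  ctx_range (fun i hi => Or.inr (Logic.infer hG 6 (by decide) (FregeSystem.sub [K, var (a i), var (b i), var (d i)]) rfl
    (FregeSystem.prems_cons (holds_eqW_iff.1 h₁ i hi) (FregeSystem.prems_cons (holds_eqW_iff.1 h₂ i hi)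
      FregeSystem.prems_nil)))) fun _ _ => (size_eqv _ _).le

/-- **Transport of a literal vector** along a bitwise equality. [cite: CookReckhow1979, §2] -/
theorem litW_transport (hG : ∀ r ∈ Logic.rules, r ∈ G.rules) (h₁ : Holds K Γ (litW a bits W))
    (h₂ : Holds K Γ (eqW a b W)) : G.Yields Γ (ctxSet K (litW b bits W)) (W * (K.size + 3)) := by
  refine ctx_range (fun i hi => Or.inr ?_) fun _ _ => size_lit_le _ _
  have hl := holds_litW_iff.1 h₁ i hi
  have he := holds_eqW_iff.1 h₂ i hi
  cases hb : bits i <;> rw [hb] at hl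
  · exact Logic.infer hG 8 (by decide) (FregeSystem.sub [K, var (a i), var (b i)]) rfl
      (FregeSystem.prems_cons hl (FregeSystem.prems_cons he FregeSystem.prems_nil))
  · exact Logic.infer hG 7 (by decide) (FregeSystem.sub [K, var (a i), var (b i)]) rfl
      (FregeSystem.prems_cons hl (FregeSystem.prems_cons he FregeSystem.prems_nil))

/-- **Two words carrying the same bits are bitwise equal.** [cite: CookReckhow1979, §2] -/
theorem eqW_of_litW (hG : ∀ r ∈ Logic.rules, r ∈ G.rules) (h₁ : Holds K Γ (litW a bits W))
    (h₂ : Holds K Γ (litW b bits W)) : G.Yields Γ (ctxSet K (eqW a b W)) (W * (K.size + 10)) := by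
  refine ctx_range (fun i hi => Or.inr ?_) fun _ _ => (size_eqv _ _).le
  have hl₁ := holds_litW_iff.1 h₁ i hi
  have hl₂ := holds_litW_iff.1 h₂ i hi
  cases hb : bits i <;> rw [hb] at hl₁ hl₂
  · exact Logic.infer hG 10 (by decide) (FregeSystem.sub [K, var (a i), var (b i)]) rfl
      (FregeSystem.prems_cons hl₁ (FregeSystem.prems_cons hl₂ FregeSystem.prems_nil))
  · exact Logic.infer hG 9 (by decide) (FregeSystem.sub [K, var (a i), var (b i)]) rfl
      (FregeSystem.prems_cons hl₁ (FregeSystem.prems_cons hl₂ FregeSystem.prems_nil))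

/-- **Clash**: a true bit provably equal to a false bit yields `K ∨ ⊥`. [cite: CookReckhow1979, §2] -/
theorem clash (hG : ∀ r ∈ Logic.rules, r ∈ G.rules) {u v : ℕ} (h₁ : ctx K (var u) ∈ Γ)
    (h₂ : ctx K (neg (var v)) ∈ Γ) (h₃ : ctx K (eqv u v) ∈ Γ) : G.Yields Γ {ctx K (const false)} (K.size + 2) := by
  have h := single (Logic.infer hG 18 (by decide) (S := Γ) (FregeSystem.sub [K, var u, var v])
    (θ := ctx K (const false)) rfl
    (FregeSystem.prems_cons h₁ (FregeSystem.prems_cons h₂ (FregeSystem.prems_cons h₃ FregeSystem.prems_nil))))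
  exact h.mono_size (by simp [ctx, size])

/-- **Literals of constant gates**: a definition line `g ↔ const b` yields the literal of `g`.
[cite: CookReckhow1979, §2] -/
theorem lit_of_cstDef (hG : ∀ r ∈ Logic.rules, r ∈ G.rules) {g : ℕ} {bv : Bool}
    (h : ctx K (biimp (var g) (const bv)) ∈ Γ) : G.Yields Γ {ctx K (lit g bv)} (K.size + 3) := by
  cases bv
  · have h' := single (Logic.infer hG 11 (by decide) (S := Γ) (FregeSystem.sub [K, var g])
      (θ := ctx K (neg (var g))) rfl (FregeSystem.prems_cons h FregeSystem.prems_nil))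
    exact h'.mono_size (by simp [ctx, size])
  · have h' := single (Logic.infer hG 12 (by decide) (S := Γ) (FregeSystem.sub [K, var g])
      (θ := ctx K (var g)) rfl (FregeSystem.prems_cons h FregeSystem.prems_nil))
    exact h'.mono_size (by simp [ctx, size])

/-- **Congruence (Leibniz) for template instances** as a derivation: two instances of a
well-formed template with available definitions and provably equal inputs have provably equal
wires. [cite: CookReckhow1979, §2] -/
theorem leib (hG : ∀ r ∈ Netlist.rules, r ∈ G.rules) {t : Template} {nIn : ℕ} (hwf : t.WF nIn)
    (I I' : Inst) (K : PropForm ℕ) (hd : I.DefsAvail t K Γ) (hd' : I'.DefsAvail t K Γ)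
    (hin : ∀ i < nIn, ctx K (eqv (I.inputs.getD i 0) (I'.inputs.getD i 0)) ∈ Γ) :
    G.Yields Γ (ctxSet K (eqW I.wire I'.wire t.length)) (t.length * (K.size + 10)) := by
  refine of_isBlock (Netlist.isBlock_leibLines hG hwf I I' K hd hd' hin t.length le_rfl) ?_ ?_
  · rintro θ ⟨L, hL, rfl⟩
    obtain ⟨k, hk, rfl⟩ := List.mem_map.1 hL
    exact Netlist.mem_leibLines (List.mem_range.1 hk)
  · exact proofSize_map_range_le fun k _ => by simp [ctx, eqv, size, FregeSystem.size_biimp]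

end Yields

end FregeSystem

/-! ### Definitions of an instance as a body list -/

namespace Netlist

open FregeSystem

/-- The definition bodies `wire k ↔ body k` of an instance of a template (context-free).
[cite: CookReckhow1979, Def. 4.1] -/
def Inst.defBodies (I : Inst) (t : Template) : List (PropForm ℕ) :=
  (I.defs t).map fun e => biimp (var e.1) e.2

/-- Availability of the contextualised definitions is `Holds` of the definition bodies.
[folklore] -/
theorem Inst.defsAvail_iff_holds {I : Inst} {t : Template} {K : PropForm ℕ} {Γ : Set (PropForm ℕ)} :
    I.DefsAvail t K Γ ↔ Holds K Γ (I.defBodies t) := by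
  constructor
  · intro h L hL
    obtain ⟨e, he, rfl⟩ := List.mem_map.1 hL
    obtain ⟨k, hk, rfl⟩ := (I.mem_defs_iff t).1 he
    exact h k hk
  · intro h k hk
    exact h _ (List.mem_map.2 ⟨_, I.wire_body_mem_defs t hk, rfl⟩)

/-- Number of definition bodies. [folklore] -/
@[simp] theorem Inst.length_defBodies (I : Inst) (t : Template) : (I.defBodies t).length = t.length := by
  simp [Inst.defBodies]

/-- Every definition body has size at most `57` (a biimplication between a variable and a gate
body over variables). [folklore] -/
theorem Inst.size_of_mem_defBodies {I : Inst} {t : Template} {L : PropForm ℕ} (h : L ∈ I.defBodies t) :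
    L.size ≤ 57 := by
  obtain ⟨e, he, rfl⟩ := List.mem_map.1 h
  obtain ⟨k, hk, rfl⟩ := (I.mem_defs_iff t).1 he
  have hb : (I.body t[k]).size ≤ 25 :=
    Kind.size_body_le fun a ha => by
      obtain ⟨r, -, rfl⟩ := List.mem_map.1 ha
      rfl
  rw [FregeSystem.size_biimp]
  simp only [size]
  omega

/-- **Weakening the definitions of an instance into an extended context.**
[cite: CookReckhow1979, §2] -/
theorem Inst.DefsAvail.weaken {G : FregeSystem} (hG : ∀ r ∈ Logic.rules, r ∈ G.rules) {I : Inst} {t : Template}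
    {K : PropForm ℕ} {Γ : Set (PropForm ℕ)} (h : I.DefsAvail t K Γ) (A : PropForm ℕ) :
    G.Yields Γ (ctxSet (disj K A) (I.defBodies t)) (t.length * (K.size + A.size + 59)) := by
  have := Yields.weaken hG (Inst.defsAvail_iff_holds.1 h) A fun L hL => Inst.size_of_mem_defBodies hL
  simpa using this

/-- After weakening, the definitions are available under the extended context. [folklore] -/
theorem Inst.defsAvail_of_ctxSet_subset {I : Inst} {t : Template} {K : PropForm ℕ} {Γ : Set (PropForm ℕ)}
    (h : ctxSet K (I.defBodies t) ⊆ Γ) : I.DefsAvail t K Γ :=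
  Inst.defsAvail_iff_holds.2 (holds_ctxSet h)

end Netlist

end Literature.Computability.MetaComplexity
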